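import Mathlib
import Summits.KontsevichZagierPeriods.KontsevichZagierPeriods.Theses.InverseLandau
import Literature.NumberTheory.Transcendental.KZCalculus
import Literature.NumberTheory.Transcendental.KZLogCalculusProofs
import Literature.NumberTheory.Transcendental.KZProductIdeal
import Literature.NumberTheory.Transcendental.KZBetaChains
import Literature.NumberTheory.Transcendental.KZDirichletCharts
import Literature.NumberTheory.Transcendental.KZGaussMultiplicationChain
import Summits.KontsevichZagierPeriods.KontsevichZagierPeriods.Theorems.BetaCancellation.Negative.KernelForm
import Summits.KontsevichZagierPeriods.KontsevichZagierPeriods.Theorems.TerasomaMultiplicationGammaHodgeSectorDefs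
import Summits.KontsevichZagierPeriods.KontsevichZagierPeriods.Theorems.TerasomaMultiplicationGammaHodgeSectorStubBetaRelators
import Summits.KontsevichZagierPeriods.KontsevichZagierPeriods.Theorems.InverseLandauTateLiftingRationalAngleSquares

/-!
# `TateLifting` (stmt-KontsevichZagierPeriods-9129), line `Sketch` — the triplication third-shift

Stub `stub_triplicationThirdShift` of the crux `TateLifting` (kernel form of the Kontsevich–Zagier
period conjecture), verbatim the item `TriplicationThirdShift` (stmt-KontsevichZagierPeriods-6875)
of route WZCosetWall: for every rational `x > 0`, every representation
`r = [(0,1)², (3x+1)·z₀^{x−2/3}(1−z₀)^{x−1/3}·z₁^{2x}(1−z₁)^{x}]` and every representation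
`r' = [(0,1)², x·z₀^{x−1}(1−z₀)^{x−2/3}·z₁^{2x−2/3}(1−z₁)^{x−1/3}]` are `KZ.Equivalent` — the
`1/3`-periodicity `(3x+1)·I(x+1/3) = x·I(x)` of `I(x) = B(x, x+1/3)·B(2x+1/3, x+2/3)` (Gauss
triplication read on one coset) realised INSIDE the rules, with no `Γ`-function identity.

## Proof (`tateLifting_triplicationThirdShift`)

Write `(a, b, c) = (x, x + 1/3, x + 2/3)` and `β(p,q) = [(0,1), t^{p-1}(1-t)^{q-1}]`
(`GammaHodgeSectorKO.betaRep`, class `betaClass p q` in the commutative formal period ring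
`P = FormalRep ⧸ relations` of `KZRulesAssociator.lean`). Everything is Beta-product algebra in `P`:

* Fubini (rule (1) against a product, `KZ.of_sub_of_mem_relations_of_eqOn`): `r` has the domain
  and, on it, the integrand of `β(b,c) × ρ` with `ρ = (a+b+c)·β(b+c, a+1)` (`a+b+c = 3x+1`), and
  `r'` those of `β(a,b) × (x·β(a+b, c))`; so `⟦r⟧ = β(b,c)·⟦ρ⟧` and
  `⟦r'⟧ = β(a,b)·⟦[pt,x]⟧·β(a+b,c)` (`KZ.toFormalPeriod_of_mul_of`, `KZ.toFormalPeriod_of_constMul`);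
* ONE translation (integration by parts as a Newton–Leibniz move, `KZ.betaTranslation_equivalent`
  at `(b+c, a) = (2x+1, x)`): `ρ = (3x+1)·β(2x+1, x+1) ∼ x·β(2x+1, x)`, i.e.
  `⟦ρ⟧ = ⟦[pt,x]⟧·β(b+c, a)`;
* ONE reflection `t ↦ 1 − t`: `β(b+c, a) = β(a, b+c)`, and ONE Dirichlet re-association through the
  open simplex (polar and linear charts, `KZ.dirichletPolar_equivalent` /
  `KZ.dirichletLinear_equivalent`): `β(a,b)·β(a+b,c) = β(b,c)·β(a,b+c)` — both packaged in the
  landed `GammaHodgeSectorKO.stub_betaRelators`;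
* hence `⟦r⟧ = ⟦[pt,x]⟧·β(b,c)·β(a,b+c) = ⟦[pt,x]⟧·β(a,b)·β(a+b,c) = ⟦r'⟧`, and
  `KZ.toFormalPeriod_eq_iff` turns the equality of classes into `KZ.Equivalent r r'`.

Value check: both sides equal `Γ(x+1)Γ(x+1/3)Γ(x+2/3)/Γ(3x+1)`.

References: M. Kontsevich, D. Zagier, *Periods* (2001), §1.2; G. Andrews, R. Askey, R. Roy,
*Special Functions* (1999), §1.1 and Thm 1.8.1.
-/

noncomputable section

namespace Summit.KontsevichZagierPeriods.InverseLandau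

open MeasureTheory Set
open Literature.NumberTheory.Transcendental
open Summit.KontsevichZagierPeriods.GammaHodgeSectorKO (betaRep betaRep_domain betaRep_integrand
  betaClass betaClass_eq stub_betaRelators)
open Summit.KontsevichZagierPeriods.KontsevichZagierPeriods.BetaCancellationNegative (betaKernel
  mem_unitIoo)

namespace TriplicationThirdShift

/-! ## Products of two Beta representations, the second one scaled -/

/-- The Fubini product `β(p,q) × (κ·β(p',q'))` lives on the open box `(0,1)²` (in the `∀ i`
spelling of the item). [folklore] -/
theorem prod_domain_eq (p q p' q' : ℚ) (hp : 0 < p) (hq : 0 < q) (hp' : 0 < p') (hq' : 0 < q')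
    (κ : ℝ) (hκ : IsAlgebraic ℚ κ) :
    ((betaRep p q hp hq).prod ((betaRep p' q' hp' hq').constMul κ hκ)).domain =
      {z : Fin 2 → ℝ | ∀ i, z i ∈ Set.Ioo (0:ℝ) 1} := by
  ext z
  simp only [KZ.IntegralRep.prod_domain, KZ.IntegralRep.mem_prodDomain,
    KZ.IntegralRep.domain_constMul, betaRep_domain, mem_unitIoo, mem_setOf_eq, mem_Ioo,
    Fin.forall_fin_two, RationalAngleSquares.castAdd_one_zero, RationalAngleSquares.natAdd_one_zero]

/-- The integrand of the Fubini product `β(p,q) × (κ·β(p',q'))`, coordinatewise: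
`z₀^{p-1}(1-z₀)^{q-1} · (κ · z₁^{p'-1}(1-z₁)^{q'-1})` (`KZ.IntegralRep.prod_integrand_eq`). [folklore] -/
theorem prod_integrand_apply (p q p' q' : ℚ) (hp : 0 < p) (hq : 0 < q) (hp' : 0 < p')
    (hq' : 0 < q') (κ : ℝ) (hκ : IsAlgebraic ℚ κ) (z : Fin (1 + 1) → ℝ) :
    ((betaRep p q hp hq).prod ((betaRep p' q' hp' hq').constMul κ hκ)).integrand z =
      (z 0) ^ ((p:ℝ) - 1) * (1 - z 0) ^ ((q:ℝ) - 1) *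
        (κ * ((z 1) ^ ((p':ℝ) - 1) * (1 - z 1) ^ ((q':ℝ) - 1))) := by
  rw [KZ.IntegralRep.prod_integrand_eq, KZ.IntegralRep.prodFun_apply]
  simp only [betaRep_integrand, KZ.IntegralRep.integrand_constMul,
    RationalAngleSquares.castAdd_one_zero, RationalAngleSquares.natAdd_one_zero, betaKernel]

end TriplicationThirdShift

open TriplicationThirdShift in
/-- **The triplication third-shift** (item `TriplicationThirdShift`, stmt-KontsevichZagierPeriods-6875,
route WZCosetWall; stub `stub_triplicationThirdShift` of line `Sketch` of crux `TateLifting`): for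
rational `x > 0`, `[(0,1)², (3x+1) z₀^{x−2/3}(1−z₀)^{x−1/3} z₁^{2x}(1−z₁)^{x}] ∼
[(0,1)², x z₀^{x−1}(1−z₀)^{x−2/3} z₁^{2x−2/3}(1−z₁)^{x−1/3}]`. With `(a,b,c) = (x, x+1/3, x+2/3)`,
in the formal period ring: `⟦r⟧ = β(b,c)·⟦(3x+1)β(b+c,a+1)⟧` and `⟦r'⟧ = ⟦[pt,x]⟧β(a,b)β(a+b,c)`
(Fubini, rule (1)); ONE translation `(3x+1)β(2x+1,x+1) ∼ xβ(2x+1,x)`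
(`KZ.betaTranslation_equivalent`), ONE reflection `β(b+c,a) = β(a,b+c)` and ONE Dirichlet
re-association `β(a,b)β(a+b,c) = β(b,c)β(a,b+c)` (`GammaHodgeSectorKO.stub_betaRelators`, i.e.
`KZ.betaReflection_equivalent` and the two Dirichlet charts); then `KZ.toFormalPeriod_eq_iff`.
[cite: AndrewsAskeyRoy1999, Thm 1.8.1] -/
theorem tateLifting_triplicationThirdShift :
    ∀ x : ℚ, 0 < x → ∀ (r r' : KZ.IntegralRep 2), r.domain = {z | ∀ i, z i ∈ Set.Ioo (0:ℝ) 1} →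
      Set.EqOn r.integrand (fun z => (3 * (x : ℝ) + 1) * (z 0) ^ ((x : ℝ) - 2/3) *
        (1 - z 0) ^ ((x : ℝ) - 1/3) * (z 1) ^ (2 * (x : ℝ)) * (1 - z 1) ^ (x : ℝ)) r.domain →
      r'.domain = {z | ∀ i, z i ∈ Set.Ioo (0:ℝ) 1} →
      Set.EqOn r'.integrand (fun z => (x : ℝ) * (z 0) ^ ((x : ℝ) - 1) *
        (1 - z 0) ^ ((x : ℝ) - 2/3) * (z 1) ^ (2 * (x : ℝ) - 2/3) *
        (1 - z 1) ^ ((x : ℝ) - 1/3)) r'.domain →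
      KZ.Equivalent r r' := by
  intro x hx r r' hrd hri hr'd hr'i
  -- the Dirichlet parameters `(a, b, c) = (x, x + 1/3, x + 2/3)`
  obtain ⟨b, hb⟩ : ∃ b : ℚ, b = x + 1/3 := ⟨_, rfl⟩
  obtain ⟨c, hc⟩ : ∃ c : ℚ, c = x + 2/3 := ⟨_, rfl⟩
  have hb0 : 0 < b := by rw [hb]; positivity
  have hc0 : 0 < c := by rw [hc]; positivity
  have hab : 0 < x + b := by rw [hb]; positivity
  have hbc : 0 < b + c := by rw [hb, hc]; positivity
  have ha1 : 0 < x + 1 := by positivity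
  have hxalg : IsAlgebraic ℚ ((x:ℚ):ℝ) := isAlgebraic_algebraMap x
  have hκalg : IsAlgebraic ℚ (((b + c + x : ℚ)):ℝ) := isAlgebraic_algebraMap (b + c + x)
  -- exponent and scalar bookkeeping (casts of the rational parameters)
  have e_b : ((b:ℚ):ℝ) - 1 = (x:ℝ) - 2/3 := by rw [hb]; push_cast; ring
  have e_c : ((c:ℚ):ℝ) - 1 = (x:ℝ) - 1/3 := by rw [hc]; push_cast; ring
  have e_ab : (((x + b : ℚ)):ℝ) - 1 = 2 * (x:ℝ) - 2/3 := by rw [hb]; push_cast; ring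
  have e_bc : (((b + c : ℚ)):ℝ) - 1 = 2 * (x:ℝ) := by rw [hb, hc]; push_cast; ring
  have e_a1 : (((x + 1 : ℚ)):ℝ) - 1 = (x:ℝ) := by push_cast; ring
  have e_κ : (((b + c + x : ℚ)):ℝ) = 3 * (x:ℝ) + 1 := by rw [hb, hc]; push_cast; ring
  have e_κT : (((b + c + x : ℚ)):ℝ) = (((b + c : ℚ)):ℝ) + (x:ℝ) := by push_cast; ring
  -- `r` is the product `β(b,c) × ρ`, `ρ = (3x+1)·β(b+c, x+1)`
  have h_r : KZ.toFormalPeriod (KZ.of r) = betaClass b c *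
      KZ.toFormalPeriod (KZ.of ((betaRep (b + c) (x + 1) hbc ha1).constMul _ hκalg)) := by
    rw [betaClass_eq b c hb0 hc0, KZ.toFormalPeriod_of_mul_of]
    refine KZ.Equivalent.toFormalPeriod_eq (KZ.of_sub_of_mem_relations_of_eqOn ?_ fun z hz => ?_)
    · rw [hrd]
      exact prod_domain_eq b c (b + c) (x + 1) hb0 hc0 hbc ha1 _ hκalg
    · rw [hri hz]
      dsimp only
      rw [prod_integrand_apply, e_b, e_c, e_bc, e_a1, e_κ]
      ring
  -- ONE translation: `(3x+1)·β(2x+1, x+1) ∼ x·β(2x+1, x)`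
  have h_T : KZ.toFormalPeriod (KZ.of ((betaRep (b + c) (x + 1) hbc ha1).constMul _ hκalg)) =
      KZ.toFormalPeriod (KZ.of ((betaRep (b + c) x hbc hx).constMul _ hxalg)) := by
    refine KZ.Equivalent.toFormalPeriod_eq (KZ.betaTranslation_equivalent (b + c) x hbc hx _ _ rfl
      (fun z _ => ?_) rfl (fun z _ => ?_))
    · simp only [KZ.IntegralRep.integrand_constMul, betaRep_integrand, betaKernel]
      rw [e_a1, e_κT]
    · simp only [KZ.IntegralRep.integrand_constMul, betaRep_integrand, betaKernel]
  -- constants factor out: `⟦x·β(b+c, x)⟧ = ⟦[pt, x]⟧·β(b+c, x)`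
  have h_K : KZ.toFormalPeriod (KZ.of ((betaRep (b + c) x hbc hx).constMul _ hxalg)) =
      KZ.toFormalPeriod (KZ.of (KZ.IntegralRep.unit.constMul _ hxalg)) * betaClass (b + c) x := by
    rw [KZ.toFormalPeriod_of_constMul, betaClass_eq (b + c) x hbc hx]
  -- ONE reflection and ONE Dirichlet re-association (landed Beta relators)
  have h_S : betaClass (b + c) x = betaClass x (b + c) := stub_betaRelators.1 (b + c) x hbc hx
  have h_D : betaClass x b * betaClass (x + b) c = betaClass b c * betaClass x (b + c) :=
    stub_betaRelators.2.2.2.1 x b c hx hb0 hc0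
  -- `r'` is the product `β(x,b) × (x·β(x+b, c))`
  have h_r' : KZ.toFormalPeriod (KZ.of r') = betaClass x b *
      (KZ.toFormalPeriod (KZ.of (KZ.IntegralRep.unit.constMul _ hxalg)) * betaClass (x + b) c) := by
    rw [betaClass_eq x b hx hb0, betaClass_eq (x + b) c hab hc0, ← KZ.toFormalPeriod_of_constMul,
      KZ.toFormalPeriod_of_mul_of]
    refine KZ.Equivalent.toFormalPeriod_eq (KZ.of_sub_of_mem_relations_of_eqOn ?_ fun z hz => ?_)
    · rw [hr'd]
      exact prod_domain_eq x b (x + b) c hx hb0 hab hc0 _ hxalg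
    · rw [hr'i hz]
      dsimp only
      rw [prod_integrand_apply, e_b, e_ab, e_c]
      ring
  -- assemble in the formal period ring
  have key : KZ.toFormalPeriod (KZ.of r) = KZ.toFormalPeriod (KZ.of r') := by
    rw [h_r, h_T, h_K, h_S, h_r']
    linear_combination (-KZ.toFormalPeriod (KZ.of (KZ.IntegralRep.unit.constMul _ hxalg))) * h_D
  exact KZ.toFormalPeriod_eq_iff.mp key

end Summit.KontsevichZagierPeriods.InverseLandau

end
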